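import Literature.Probability.Percolation.FoldingFibresHarris
import Literature.Probability.Percolation.FoldingFibres
import HarnessLib

/-!
# The rank-graded Harris inequality (Björner's `q`-FKG inequality on the Boolean lattice), fibre by fibre

Topic `Literature/Probability/Percolation` (configurations `Set ι`, `ι` finite, the inhomogeneous
product measure `μ = prodBernoulli p` of `Literature.Probability.LatticeModels`; companion of
`FoldingFibres.lean` / `FoldingFibresHarris.lean`).  Theorems only: no definition, no named fact.

For an event `C ⊆ Set ι` write `P_C(q) = ∑_j μ(C ∩ N_j) q^j`, `N_j = {a : |a| = j}` the `j`-th level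
of the cube.  Björner's **`q`-FKG inequality** (Combinatorica 31 (2011), Thm. 2.1) reads, for the
distributive lattice `L = 2^ι` with rank function `r(a) = |a|`, the (modular, hence log-supermodular)
product weight `μ` and the comonotone indicator functions `g = 1_A`, `h = 1_B` of two increasing
events:

  `P_A(q) · P_B(q) ≪ P_Ω(q) · P_{A ∩ B}(q)`  (`≪` = coefficientwise domination of polynomials in `q`),

i.e. for every `m : ℕ`

  `∑_{j+k=m} μ(A ∩ N_j) μ(B ∩ N_k) ≤ ∑_{j+k=m} μ(A ∩ B ∩ N_j) μ(N_k)`      (`prodBernoulli_gradedHarris`).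

Putting `q = 1` (summing over `m`) returns Harris' inequality `μ(A) μ(B) ≤ μ(A ∩ B)`; for the uniform
weight it is Björner's Thm. 3.1 on `f`-polynomials of two simplicial complexes ("for `q = 1` the
theorem specializes to a result of Kleitman").  The proof here is the tree's folding-fibre route
(`FoldingFibres.lean`): group the pairs `(a, b)` by the disagreement set `M = a ∆ b` and the common
value `u = a \ M` off `M` — this is exactly the class `{(x, y) : x ∧ y = u, x ∨ y = u ∪ M}` of
Björner's proof ("Claim: `ψ(u,v) ≥ 0`" on every interval) — and observe that the total rank
`|a| + |a ∆ M| = 2|u| + |M|` is CONSTANT on a fibre (`FoldingFibre.ncard_add_ncard_symmDiff`), so each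
fibre contributes to a single coefficient; the fibrewise Harris count
`FoldingFibre.fibreCount_le_of_isUpperSet` (Kleitman's lemma twice) then gives the graded
inequality coefficient by coefficient (`prodBernoulli_graded_mul_le_of_fibrewise`, the graded form of
`prodBernoulli_real_mul_le_of_fibrewise`).  For an increasing and a decreasing event the inequality is
reversed (`prodBernoulli_gradedHarris_upper_lower`; Björner: "For countermonotone functions the
inequality is reversed").

-- TODO(general form): Björner's Thm. 2.1 is stated for an arbitrary finite distributive lattice and
-- an arbitrary log-supermodular weight; here only `L = 2^ι` with a product weight (the case met in
-- the harness: run/shared/lean/prim/prim-ineq-prove-3/FINDING-G19-NA-SHRINK-MONOP.md §4.1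
-- "POLY-HARRIS", verified there for `d ≤ 5` and recognised as Björner's theorem in
-- run/shared/lean/prim/prim-lit-2/LITERATURE-2.md §35).

## Sources, as printed

* A. Björner, *A q-analogue of the FKG inequality and some applications*, Combinatorica 31 (2011)
  151–164 = arXiv:0906.1389, **Theorem 2.1** [v arXiv p. 4]: "Let `L` be a finite distributive
  lattice, `μ : L → ℝ⁺` a log-supermodular weight function and `g` and `h` comonotone functions
  `g, h : L → ℝ⁺`. Then `E_μ(g; q) · E_μ(h; q) ≪ E_μ(1; q) · E_μ(gh; q)`.  For countermonotone
  functions the inequality is reversed."  Here `E_μ(k; q) = ∑_{x ∈ L} k(x) μ(x) q^{r(x)}` and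
  `≪` is coefficientwise `≤`.  **Theorem 3.1** [v p. 6]: `f_Δ(q) · f_Γ(q) ≪ (1+q)^{|V|} · f_{Δ∩Γ}(q)`
  for simplicial complexes `Δ, Γ` on `V`; "For `q = 1` the theorem specializes to a result of
  Kleitman [Kle]."
* D. J. Kleitman, *Families of non-disjoint subsets*, J. Combin. Theory 1 (1966) 153–155 (the
  fibrewise count, via `FoldingFibresHarris.lean`).

## Mathlib / tree

Tree: `prodBernoulli_real_mul_eq_sum_fibres`, `BHK2006.weight_nonneg` (`FoldingFibres.lean`,
`ConditionalPositiveAssociationProofs.lean`), `FoldingFibre.fibreCount_le_of_isUpperSet`,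
`FoldingFibre.fibreCount_le_of_isUpperSet_isLowerSet` (`FoldingFibresHarris.lean`).  Mathlib:
`Finset.antidiagonal`, `Finset.card_eq_sum_card_fiberwise`, `Set.ncard_union_eq`,
`Set.ncard_inter_add_ncard_sdiff_eq_ncard`.  `lean search` found no graded / `q`-FKG declaration in
the tree before this file (the docstring of `FoldingFibresFourFunctions.lean` cites Björner's theorem
as context only).

## References

* [Bjorner2011] A. Björner, A q-analogue of the FKG inequality and some applications, Combinatorica 31
  (2011) 151–164, Thm 2.1, Thm 3.1.
* [Kleitman1966] D. J. Kleitman, Families of non-disjoint subsets, J. Combin. Theory 1 (1966) 153–155.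
-/

noncomputable section

open MeasureTheory Set
open scoped symmDiff Classical
open Literature.Probability.LatticeModels (prodBernoulli)

namespace Literature.Probability.Percolation

variable {ι : Type*} [Fintype ι]

open BHK2006 DecisionTree

namespace FoldingFibre

/-- **The total rank is constant on a folding fibre**: if `a \ M = u` then
`|a| + |a ∆ M| = 2|u| + |M|` (`a = u ⊔ (a ∩ M)`, `a ∆ M = u ⊔ (M \ a)`).  This is why a folding fibre
`(M, u)` — Björner's class `{(x,y) : x ∧ y = u, x ∨ y = u ∪ M}` — contributes to a single power of
`q`. [cite: Bjorner2011, §2 (proof of Thm 2.1: grouping by `(x ∧ y, x ∨ y)`, `r(x)+r(y) = r(x∧y)+r(x∨y)`)] -/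
theorem ncard_add_ncard_symmDiff {M u a : Set ι} (ha : a \ M = u) :
    a.ncard + (a ∆ M).ncard = 2 * u.ncard + M.ncard := by
  have h1 : (a ∩ M).ncard + (a \ M).ncard = a.ncard := Set.ncard_inter_add_ncard_sdiff_eq_ncard a M
  have h2 : (M ∩ a).ncard + (M \ a).ncard = M.ncard := Set.ncard_inter_add_ncard_sdiff_eq_ncard M a
  have h3 : (a ∆ M).ncard = (a \ M).ncard + (M \ a).ncard := by
    rw [Set.symmDiff_def]
    exact Set.ncard_union_eq disjoint_sdiff_sdiff
  rw [Set.inter_comm] at h2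
  rw [ha] at h1 h3
  omega

/-- **Regrouping a graded fibre count.**  On the fibre `(M, u)` the pairs `(a, a ∆ M)` with
`a ∈ C`, `a ∆ M ∈ D` and prescribed levels `|a| = j`, `|a ∆ M| = k`, summed over `j + k = m`, count
ALL such pairs if `2|u| + |M| = m` and none otherwise (plumbing for
`prodBernoulli_graded_mul_eq_sum_fibres`). [folklore] -/
private theorem sum_antidiagonal_fibreCount (C D : Set (Set ι)) (M u : Set ι) (m : ℕ) :
    ∑ jk ∈ Finset.antidiagonal m,
        (Finset.univ.filter fun a : Set ι =>
          a \ M = u ∧ a ∈ C ∩ {a | a.ncard = jk.1} ∧ a ∆ M ∈ D ∩ {b | b.ncard = jk.2}).card =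
      if 2 * u.ncard + M.ncard = m then
        (Finset.univ.filter fun a : Set ι => a \ M = u ∧ a ∈ C ∧ a ∆ M ∈ D).card else 0 := by
  split_ifs with hm
  · -- every `a` on the fibre has total rank `m`: decompose the plain count along `(|a|, |a ∆ M|)`
    symm
    rw [Finset.card_eq_sum_card_fiberwise (f := fun a : Set ι => (a.ncard, (a ∆ M).ncard))
      (t := Finset.antidiagonal m)]
    · refine Finset.sum_congr rfl fun jk _ => ?_
      congr 1
      ext a
      simp only [Finset.mem_filter, Finset.mem_univ, true_and, Set.mem_inter_iff, Set.mem_setOf_eq,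
        Prod.ext_iff]
      tauto
    · intro a ha
      have ha' := Finset.mem_filter.1 (Finset.mem_coe.1 ha)
      simp only [Finset.mem_coe, Finset.mem_antidiagonal]
      rw [ncard_add_ncard_symmDiff ha'.2.1, hm]
  · -- no `a` on the fibre has total rank `m`
    refine Finset.sum_eq_zero fun jk hjk => ?_
    rw [Finset.card_eq_zero, Finset.filter_eq_empty_iff]
    rintro a - ⟨hau, ⟨-, hj⟩, ⟨-, hk⟩⟩
    rw [Set.mem_setOf_eq] at hj hk
    rw [Finset.mem_antidiagonal] at hjk
    apply hm
    rw [← hjk, ← hj, ← hk]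
    exact (ncard_add_ncard_symmDiff hau).symm

end FoldingFibre

/-- **Graded folding identity**: the `m`-th coefficient of `P_C(q) · P_D(q)`,
`∑_{j+k=m} μ(C ∩ N_j) μ(D ∩ N_k)`, equals `∑_M ∑_u w(u) w(u ∆ M) · [2|u|+|M| = m] · #{a : a \ M = u,
a ∈ C, a ∆ M ∈ D}` for `μ = prodBernoulli p`. [cite: Bjorner2011, §2 (proof of Thm 2.1)] -/
theorem prodBernoulli_graded_mul_eq_sum_fibres (p : ι → unitInterval) (C D : Set (Set ι)) (m : ℕ) :
    ∑ jk ∈ Finset.antidiagonal m,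
        (prodBernoulli p).real (C ∩ {a | a.ncard = jk.1}) *
          (prodBernoulli p).real (D ∩ {b | b.ncard = jk.2}) =
      ∑ M : Set ι, ∑ u : Set ι,
        weight (fun e => (p e : ℝ)) u * weight (fun e => (p e : ℝ)) (u ∆ M) *
          (if 2 * u.ncard + M.ncard = m then
            ((Finset.univ.filter fun a : Set ι => a \ M = u ∧ a ∈ C ∧ a ∆ M ∈ D).card : ℝ)
           else 0) := by
  simp_rw [prodBernoulli_real_mul_eq_sum_fibres p]
  rw [Finset.sum_comm]
  refine Finset.sum_congr rfl fun M _ => ?_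
  rw [Finset.sum_comm]
  refine Finset.sum_congr rfl fun u _ => ?_
  rw [← Finset.mul_sum]
  congr 1
  have h := congrArg (Nat.cast : ℕ → ℝ) (FoldingFibre.sum_antidiagonal_fibreCount C D M u m)
  push_cast at h
  -- the two sides agree up to (defeq) instance paths
  convert h using 3 <;> first | rfl | (congr 1; ext a; simp)

/-- **Fibrewise domination implies the GRADED product inequality**: if on every folding fibre
`(M, u)` (`u ∩ M = ∅`) the count for `(A₁, B₁)` is at most the count for `(A₂, B₂)`, then
`P_{A₁}(q) · P_{B₁}(q) ≪ P_{A₂}(q) · P_{B₂}(q)` coefficientwise, for EVERY parameter vector `p` — the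
graded form of `prodBernoulli_real_mul_le_of_fibrewise`. [cite: Bjorner2011, §2 (proof of Thm 2.1)] -/
theorem prodBernoulli_graded_mul_le_of_fibrewise (p : ι → unitInterval) (A₁ B₁ A₂ B₂ : Set (Set ι))
    (h : ∀ M u : Set ι, Disjoint u M →
      (Finset.univ.filter fun a : Set ι => a \ M = u ∧ a ∈ A₁ ∧ a ∆ M ∈ B₁).card ≤
        (Finset.univ.filter fun a : Set ι => a \ M = u ∧ a ∈ A₂ ∧ a ∆ M ∈ B₂).card) (m : ℕ) :
    ∑ jk ∈ Finset.antidiagonal m,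
        (prodBernoulli p).real (A₁ ∩ {a | a.ncard = jk.1}) *
          (prodBernoulli p).real (B₁ ∩ {b | b.ncard = jk.2}) ≤
      ∑ jk ∈ Finset.antidiagonal m,
        (prodBernoulli p).real (A₂ ∩ {a | a.ncard = jk.1}) *
          (prodBernoulli p).real (B₂ ∩ {b | b.ncard = jk.2}) := by
  rw [prodBernoulli_graded_mul_eq_sum_fibres p A₁ B₁ m, prodBernoulli_graded_mul_eq_sum_fibres p A₂ B₂ m]
  refine Finset.sum_le_sum fun M _ => Finset.sum_le_sum fun u _ => ?_
  have hw0 : ∀ e, 0 ≤ (fun e => (p e : ℝ)) e := fun e => (p e).2.1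
  have hw1 : ∀ e, (fun e => (p e : ℝ)) e ≤ 1 := fun e => (p e).2.2
  refine mul_le_mul_of_nonneg_left ?_
    (mul_nonneg (weight_nonneg hw0 hw1 _) (weight_nonneg hw0 hw1 _))
  split_ifs with hm
  · by_cases hd : Disjoint u M
    · exact_mod_cast h M u hd
    · -- off the locus `u ∩ M = ∅` both fibres are empty
      have hempty : ∀ C D : Set (Set ι),
          (Finset.univ.filter fun a : Set ι => a \ M = u ∧ a ∈ C ∧ a ∆ M ∈ D) = ∅ := by
        intro C D
        refine Finset.filter_eq_empty_iff.2 fun a _ ha => hd ?_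
        rw [← ha.1]
        exact disjoint_sdiff_self_left
      rw [hempty, hempty]
  · exact le_rfl

/-- **The rank-graded Harris inequality = Björner's `q`-FKG inequality on `2^ι` with a product
weight** (Thm. 2.1 with `L = 2^ι`, `r = |·|`, `μ` the product weight, `g = 1_A`, `h = 1_B`): for
increasing events `A, B` and every `m`,
`∑_{j+k=m} μ(A ∩ N_j) μ(B ∩ N_k) ≤ ∑_{j+k=m} μ(A ∩ B ∩ N_j) μ(N_k)`, i.e.
`P_A(q) P_B(q) ≪ P_{A∩B}(q) P_Ω(q)`; at `q = 1` this is Harris' inequality, for the uniform weight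
it is Thm. 3.1 (`f_Δ f_Γ ≪ (1+q)^{|V|} f_{Δ∩Γ}`, Kleitman at `q = 1`).
[cite: Bjorner2011, Thm 2.1 (case L = 2^V, product weight, indicator functions); Thm 3.1] -/
theorem prodBernoulli_gradedHarris (p : ι → unitInterval) {A B : Set (Set ι)}
    (hA : IsUpperSet A) (hB : IsUpperSet B) (m : ℕ) :
    ∑ jk ∈ Finset.antidiagonal m,
        (prodBernoulli p).real (A ∩ {a | a.ncard = jk.1}) *
          (prodBernoulli p).real (B ∩ {b | b.ncard = jk.2}) ≤
      ∑ jk ∈ Finset.antidiagonal m,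
        (prodBernoulli p).real (A ∩ B ∩ {a | a.ncard = jk.1}) *
          (prodBernoulli p).real {b | b.ncard = jk.2} := by
  have h := prodBernoulli_graded_mul_le_of_fibrewise p A B (A ∩ B) Set.univ
    (fun M u _ => by convert FoldingFibre.fibreCount_le_of_isUpperSet hA hB M u) m
  simpa only [Set.univ_inter] using h

/-- **Reversed for an increasing and a decreasing event** (Björner: "For countermonotone functions
the inequality is reversed"): `P_{A∩B}(q) P_Ω(q) ≪ P_A(q) P_B(q)` for `A` increasing, `B` decreasing.
[cite: Bjorner2011, Thm 2.1 (countermonotone case, L = 2^V, product weight)] -/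
theorem prodBernoulli_gradedHarris_upper_lower (p : ι → unitInterval) {A B : Set (Set ι)}
    (hA : IsUpperSet A) (hB : IsLowerSet B) (m : ℕ) :
    ∑ jk ∈ Finset.antidiagonal m,
        (prodBernoulli p).real (A ∩ B ∩ {a | a.ncard = jk.1}) *
          (prodBernoulli p).real {b | b.ncard = jk.2} ≤
      ∑ jk ∈ Finset.antidiagonal m,
        (prodBernoulli p).real (A ∩ {a | a.ncard = jk.1}) *
          (prodBernoulli p).real (B ∩ {b | b.ncard = jk.2}) := by
  have h := prodBernoulli_graded_mul_le_of_fibrewise p (A ∩ B) Set.univ A B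
    (fun M u _ => by convert FoldingFibre.fibreCount_le_of_isUpperSet_isLowerSet hA hB M u) m
  simpa only [Set.univ_inter] using h

/-- **`q = 1` recovers Harris**: summing the graded inequality over all total ranks `m ≤ 2|ι|`
gives back `μ(A) μ(B) ≤ μ(A ∩ B)` — recorded as the consistency check that the graded statement
specialises correctly ("The original FKG inequality is obtained by putting `q = 1`").
[cite: Bjorner2011, §2 (remark after Thm 2.1)] -/
theorem prodBernoulli_real_eq_sum_levels (p : ι → unitInterval) (C : Set (Set ι)) :
    (prodBernoulli p).real C =
      ∑ j ∈ Finset.range (Fintype.card ι + 1), (prodBernoulli p).real (C ∩ {a | a.ncard = j}) := by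
  classical
  simp_rw [prodBernoulli_real_eq_sum_weight_ind p]
  rw [Finset.sum_comm]
  refine Finset.sum_congr rfl fun a _ => ?_
  rw [← Finset.mul_sum]
  congr 1
  have ha : a.ncard ∈ Finset.range (Fintype.card ι + 1) := by
    rw [Finset.mem_range, Nat.lt_succ_iff]
    calc a.ncard ≤ (Set.univ : Set ι).ncard := Set.ncard_le_ncard (Set.subset_univ a)
      _ = Fintype.card ι := by rw [Set.ncard_univ, Nat.card_eq_fintype_card]
  rw [Finset.sum_eq_single_of_mem a.ncard ha]
  · by_cases hC : a ∈ C
    · rw [ind_of_mem hC, ind_of_mem (show a ∈ C ∩ {b | b.ncard = a.ncard} from ⟨hC, rfl⟩)]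
    · rw [ind_of_not_mem hC, ind_of_not_mem (fun h => hC h.1)]
  · intro j _ hj
    exact ind_of_not_mem fun h => hj h.2.symm

end Literature.Probability.Percolation

end
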